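import Mathlib
import Summits.NavierStokesRegularity.NavierStokesRegularity.Theorems.ThreadingFluxSilentShellsJiuXinAxis
import HarnessLib

/-!
# Crux `PoloidalLiouville` (stmt-NavierStokesRegularity-1222, W1), crux idea «silent-shells» (ns-idea-15 g8):
# (O1) Jiu–Xin's compact Liouville theorem `jiuXin_noSwirl_liouville` — PROVED

**Theorem** (Jiu–Xin, CMP 287 (2009), Thm 5.3, compact-support case).  A compactly supported `C¹` steady Euler pair
`(U, P)` on `ℝ³` — `div U = 0`, `(U·∇)U + ∇P = 0` — which is axisymmetric WITHOUT swirl has `U ≡ 0`.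

This is the sketch Prop `SilentShells.jiuXin_noSwirl_liouville` (custodian ns-idea-15, `Cruxes/PoloidalLiouville/
SilentShellsSketch.lean` v1.4 l.268) BY NAME, with the sketch-local `IsSteadyEulerC1 U P` δ-unfolded into its four
tree-vocabulary conjuncts, and its corollary `not_silentNoSwirlBlock` (l.257): SILENT NO-SWIRL BLOCKS DO NOT EXIST, so the
multi-axis compacton of the silent-shells card has no building blocks — obstruction (O1) is now a kernel theorem and the
card's «modulo the printed Jiu–Xin Thm 5.3» (critic V23-P2) is discharged without a Literature fact.

Proof (files `…JiuXinTools`, `…JiuXinAxis`, this one).  Let `P ≡ p₀` off `B̄(0,R)` (`pressure_const_outside`).  The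
generalised virial identity at the Jiu–Xin field `G_ε = x_h/(ρ²+ε²)` and the no-swirl collinearity `U_h ∥ x_h` give
`A(ε) := ∫ |U_h|²(ρ²−ε²)/(ρ²+ε²)² = ∫ (P−p₀)·2ε²/(ρ²+ε²)²` [JiuXin2008, (3.24) regularised].  As `ε → 0⁺`,
`A(ε) → L := ∫ |U_h|²/ρ² ≥ 0` (dominated convergence, `|U_h|² ≤ ‖DU‖²_∞ ρ²`), while the right side is
`≤ M_P(δ/2)·C_χ + (M_P/2δ)·I(ε)` with `I(ε) → 0` for every `δ > 0`, because ON THE AXIS `P − p₀ = −½U₂² ≤ 0` (Bernoulli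
from rest at infinity [JiuXin2008, (3.27)–(3.28)]) and `P` is `M_P`-Lipschitz.  Hence `L ≤ 0`, so `L = 0`, `U_h ≡ 0`; then
`∂₂U₂ = div U = 0` and compact support force `U₂ ≡ 0`.

`--supports stmt-NavierStokesRegularity-1222 --as helper`.  W1 movement 0; ⟨1222⟩ OPEN; NS regularity is NOT proved by
any of this (a statement about steady axisymmetric Euler compactons).
-/

-- the summit and its single problem share the name (D-0017 nested layout)
set_option linter.dupNamespace false

noncomputable section

namespace Summit.NavierStokesRegularity.NavierStokesRegularity.Theorems.PoloidalLiouville.SilentShells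

open Set Function Filter MeasureTheory Topology Metric
open scoped Topology RealInnerProductSpace
open Literature.Analysis.FluidPDE
open Summit.NavierStokesRegularity.NavierStokesRegularity.Theorems.PoloidalLiouville.HorizonTower (E3)

namespace JiuXin

/-! ## The two `ε → 0⁺` limits -/

/-- The horizontal speed squared `|U_h|² = U₀² + U₁²` is continuous. -/
theorem continuous_horSq {U : E3 → E3} (hU : Continuous U) :
    Continuous fun x => U x 0 * U x 0 + U x 1 * U x 1 := by
  have h0 : Continuous fun x => U x 0 := (EuclideanSpace.proj (0 : Fin 3) : E3 →L[ℝ] ℝ).continuous.comp hU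
  have h1 : Continuous fun x => U x 1 := (EuclideanSpace.proj (1 : Fin 3) : E3 →L[ℝ] ℝ).continuous.comp hU
  exact (h0.mul h0).add (h1.mul h1)

/-- `|U_h|² ≥ 0`. -/
theorem horSq_nonneg (U : E3 → E3) (x : E3) : 0 ≤ U x 0 * U x 0 + U x 1 * U x 1 := by
  nlinarith [mul_self_nonneg (U x 0), mul_self_nonneg (U x 1)]

/-- On the axis the horizontal speed of an axisymmetric differentiable field vanishes. -/
theorem horSq_eq_zero_of_cylSq_eq_zero {U : E3 → E3} (hax : IsAxisymmetric U) (hU : Differentiable ℝ U) {x : E3}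
    (hx : cylSq x = 0) : U x 0 * U x 0 + U x 1 * U x 1 = 0 := by
  obtain ⟨h0, h1⟩ := coord_eq_zero_of_cylSq_eq_zero hx
  rw [hax.apply_zero_eq_zero_of_axis hU h0 h1, hax.apply_one_eq_zero_of_axis hU h0 h1]
  ring

/-- `|U_h|²/ρ²` is integrable for a compactly supported axisymmetric `C¹` field (bounded by `‖DU‖²_∞` on the support). -/
theorem integrable_horSq_div {U : E3 → E3} (hU : ContDiff ℝ 1 U) (hc : HasCompactSupport U)
    (hax : IsAxisymmetric U) :
    Integrable (fun x => (U x 0 * U x 0 + U x 1 * U x 1) / cylSq x) (volume : Measure E3) := by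
  have hUd : Differentiable ℝ U := hU.differentiable one_ne_zero
  obtain ⟨M, hM⟩ := (hU.continuous_fderiv one_ne_zero).bounded_above_of_compact_support (hc.fderiv (𝕜 := ℝ))
  have hsq : ∀ x, U x 0 * U x 0 + U x 1 * U x 1 ≤ M ^ 2 * cylSq x := horSq_le_of_isAxisymmetric hax hUd hM
  have hKc : IsCompact (tsupport U) := hc
  refine Integrable.mono' ((integrable_indicator_iff hKc.measurableSet).mpr
    (integrableOn_const hKc.measure_lt_top.ne) : Integrable ((tsupport U).indicator fun _ => M ^ 2))
    (((continuous_horSq hU.continuous).measurable.div continuous_cylSq.measurable).aestronglyMeasurable)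
    (Eventually.of_forall fun x => ?_)
  by_cases hx : x ∈ tsupport U
  · rw [indicator_of_mem hx, Real.norm_eq_abs, abs_of_nonneg (div_nonneg (horSq_nonneg U x) (cylSq_nonneg x))]
    by_cases hq : cylSq x = 0
    · rw [hq, div_zero]; positivity
    · rw [div_le_iff₀ (lt_of_le_of_ne (cylSq_nonneg x) (Ne.symm hq))]
      exact hsq x
  · have hUx : U x = 0 := image_eq_zero_of_notMem_tsupport hx
    simp [indicator_of_notMem hx, hUx]

/-- **Velocity side**: `∫ |U_h|² (ρ²−ε²)/(ρ²+ε²)² → ∫ |U_h|²/ρ²` as `ε → 0⁺` (dominated convergence; the integrands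
are bounded by `‖DU‖²_∞` on the support since `|U_h|² ≤ M²ρ²`, and converge off the axis). -/
theorem tendsto_integral_horSq {U : E3 → E3} (hU : ContDiff ℝ 1 U) (hc : HasCompactSupport U)
    (hax : IsAxisymmetric U) :
    Tendsto (fun ε : ℝ => ∫ x, (U x 0 * U x 0 + U x 1 * U x 1) * ((cylSq x - ε ^ 2) / (cylSq x + ε ^ 2) ^ 2))
      (𝓝[>] 0) (𝓝 (∫ x, (U x 0 * U x 0 + U x 1 * U x 1) / cylSq x)) := by
  have hUd : Differentiable ℝ U := hU.differentiable one_ne_zero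
  obtain ⟨M, hM⟩ := (hU.continuous_fderiv one_ne_zero).bounded_above_of_compact_support (hc.fderiv (𝕜 := ℝ))
  have hsq : ∀ x, U x 0 * U x 0 + U x 1 * U x 1 ≤ M ^ 2 * cylSq x := horSq_le_of_isAxisymmetric hax hUd hM
  have hKc : IsCompact (tsupport U) := hc
  refine tendsto_integral_filter_of_dominated_convergence ((tsupport U).indicator fun _ => M ^ 2) ?_ ?_ ?_ ?_
  · filter_upwards [self_mem_nhdsWithin] with ε (hε : 0 < ε)
    refine Continuous.aestronglyMeasurable ((continuous_horSq hU.continuous).mul ?_)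
    exact (continuous_cylSq.sub continuous_const).div ((continuous_cylSq.add continuous_const).pow 2)
      fun x => pow_ne_zero 2 (cylSq_add_sq_pos hε.ne' x).ne'
  · filter_upwards [self_mem_nhdsWithin] with ε (hε : 0 < ε)
    refine Eventually.of_forall fun x => ?_
    by_cases hx : x ∈ tsupport U
    · have hq := cylSq_add_sq_pos hε.ne' x
      rw [indicator_of_mem hx, Real.norm_eq_abs, abs_mul, abs_of_nonneg (horSq_nonneg U x), abs_div,
        abs_of_pos (pow_pos hq 2)]
      have h1 : |cylSq x - ε ^ 2| ≤ cylSq x + ε ^ 2 :=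
        abs_le.mpr ⟨by nlinarith [cylSq_nonneg x, sq_nonneg ε], by nlinarith [cylSq_nonneg x, sq_nonneg ε]⟩
      calc (U x 0 * U x 0 + U x 1 * U x 1) * (|cylSq x - ε ^ 2| / (cylSq x + ε ^ 2) ^ 2)
          ≤ (M ^ 2 * cylSq x) * ((cylSq x + ε ^ 2) / (cylSq x + ε ^ 2) ^ 2) := by
            gcongr
            · exact mul_nonneg (sq_nonneg M) (cylSq_nonneg x)
            · exact hsq x
        _ = M ^ 2 * (cylSq x / (cylSq x + ε ^ 2)) := by field_simp
        _ ≤ M ^ 2 * 1 := by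
            gcongr
            rw [div_le_one hq]; nlinarith [sq_nonneg ε]
        _ = M ^ 2 := mul_one _
    · have hUx : U x = 0 := image_eq_zero_of_notMem_tsupport hx
      simp [indicator_of_notMem hx, hUx]
  · exact (integrable_indicator_iff hKc.measurableSet).mpr (integrableOn_const hKc.measure_lt_top.ne)
  · refine Eventually.of_forall fun x => ?_
    by_cases hq : cylSq x = 0
    · have hs0 := horSq_eq_zero_of_cylSq_eq_zero hax hUd hq
      simp only [hs0, zero_mul, zero_div]
      exact tendsto_const_nhds
    · have hqp : 0 < cylSq x := lt_of_le_of_ne (cylSq_nonneg x) (Ne.symm hq)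
      have hcont : Continuous fun ε : ℝ =>
          (U x 0 * U x 0 + U x 1 * U x 1) * ((cylSq x - ε ^ 2) / (cylSq x + ε ^ 2) ^ 2) :=
        continuous_const.mul ((continuous_const.sub (continuous_pow 2)).div
          ((continuous_const.add (continuous_pow 2)).pow 2) fun ε => by positivity)
      have h := (hcont.tendsto 0).mono_left (nhdsWithin_le_nhds (s := Ioi (0 : ℝ)))
      have hval : (U x 0 * U x 0 + U x 1 * U x 1) * ((cylSq x - (0 : ℝ) ^ 2) / (cylSq x + (0 : ℝ) ^ 2) ^ 2) =
          (U x 0 * U x 0 + U x 1 * U x 1) / cylSq x := by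
        field_simp
        ring
      rw [hval] at h
      exact h

/-- **Cut-off side**: `∫ χ_R ρ² · 2ε²/(ρ²+ε²)² → 0` as `ε → 0⁺` (dominated by `χ_R`, pointwise to `0` off the axis). -/
theorem tendsto_integral_cutoff_cylSq_mul {R : ℝ} (hR : 0 < R) :
    Tendsto (fun ε : ℝ => ∫ x, cutoff R x * (cylSq x * (2 * ε ^ 2 / (cylSq x + ε ^ 2) ^ 2)))
      (𝓝[>] 0) (𝓝 0) := by
  have hχc : Continuous (cutoff R) := (contDiff_cutoff (n := 0) R).continuous
  have hχs : HasCompactSupport (cutoff R) := hasCompactSupport_cutoff hR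
  have h := tendsto_integral_filter_of_dominated_convergence (μ := (volume : Measure E3)) (l := 𝓝[>] (0 : ℝ))
    (F := fun ε x => cutoff R x * (cylSq x * (2 * ε ^ 2 / (cylSq x + ε ^ 2) ^ 2))) (f := fun _ => (0 : ℝ))
    (cutoff R) ?_ ?_ (hχc.integrable_of_hasCompactSupport hχs) ?_
  · simpa using h
  · filter_upwards [self_mem_nhdsWithin] with ε (hε : 0 < ε)
    refine Continuous.aestronglyMeasurable (hχc.mul (continuous_cylSq.mul ?_))
    exact continuous_const.div ((continuous_cylSq.add continuous_const).pow 2)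
      fun x => pow_ne_zero 2 (cylSq_add_sq_pos hε.ne' x).ne'
  · filter_upwards [self_mem_nhdsWithin] with ε (hε : 0 < ε)
    refine Eventually.of_forall fun x => ?_
    have hq := cylSq_add_sq_pos hε.ne' x
    have hk1 : cylSq x * (2 * ε ^ 2 / (cylSq x + ε ^ 2) ^ 2) ≤ 1 := by
      rw [mul_div_assoc', div_le_one (pow_pos hq 2)]
      nlinarith [sq_nonneg (cylSq x - ε ^ 2)]
    have hk0 : 0 ≤ cylSq x * (2 * ε ^ 2 / (cylSq x + ε ^ 2) ^ 2) :=
      mul_nonneg (cylSq_nonneg x) (by positivity)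
    rw [Real.norm_eq_abs, abs_mul, abs_of_nonneg (cutoff_nonneg R x), abs_of_nonneg hk0]
    calc cutoff R x * (cylSq x * (2 * ε ^ 2 / (cylSq x + ε ^ 2) ^ 2)) ≤ cutoff R x * 1 :=
        mul_le_mul_of_nonneg_left hk1 (cutoff_nonneg R x)
      _ = cutoff R x := mul_one _
  · refine Eventually.of_forall fun x => ?_
    by_cases hq : cylSq x = 0
    · simp only [hq, zero_mul, mul_zero]
      exact tendsto_const_nhds
    · have hqp : 0 < cylSq x := lt_of_le_of_ne (cylSq_nonneg x) (Ne.symm hq)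
      have hcont : Continuous fun ε : ℝ => cutoff R x * (cylSq x * (2 * ε ^ 2 / (cylSq x + ε ^ 2) ^ 2)) :=
        continuous_const.mul (continuous_const.mul ((continuous_const.mul (continuous_pow 2)).div
          ((continuous_const.add (continuous_pow 2)).pow 2) fun ε => by positivity))
      have h := (hcont.tendsto 0).mono_left (nhdsWithin_le_nhds (s := Ioi (0 : ℝ)))
      simpa using h

end JiuXin

/-! ## (O1) The theorem -/

open JiuXin in
/-- **(O1) Jiu–Xin's compact Liouville theorem** — silent-shells sketch v1.4 l.268 `jiuXin_noSwirl_liouville` BY NAME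
(body verbatim, the sketch-local `IsSteadyEulerC1 U P` δ-unfolded): a compactly supported `C¹` steady Euler pair on `ℝ³`
that is axisymmetric WITHOUT swirl is trivial.  [cite: JiuXin2008, Thm 5.3] (compact-support corollary; the printed
version assumes only `u ∈ L²`, `u → 0`, `p → p₀` at infinity).  The kernel proof is NOT Jiu–Xin's limiting argument
with the singular weight `∇ log ρ`: it is the regularised `G_ε`-virial identity of `JiuXin.virial_identity` plus the axis
Bernoulli sign, closed by a cut-off/AM–GM bound instead of cylindrical coordinates (critic ns-wall-crit-1 V23/P1). -/
theorem jiuXin_noSwirl_liouville :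
    ∀ (U : EuclideanSpace ℝ (Fin 3) → EuclideanSpace ℝ (Fin 3)) (P : EuclideanSpace ℝ (Fin 3) → ℝ),
      (ContDiff ℝ 1 U ∧ ContDiff ℝ 1 P ∧ VectorCalculus.IsDivFree U ∧
          ∀ x, convect U U x + gradient P x = 0) →
        HasCompactSupport U → IsAxisymmetric U → HasNoSwirl U → U = 0 := by
  intro U P hEul hc hax hsw
  obtain ⟨hU, hP, hdiv, hE⟩ := hEul
  have hUd : Differentiable ℝ U := hU.differentiable one_ne_zero
  -- pressure at infinity, `R ≥ 1`
  obtain ⟨R, hR1, hUR, p₀, hp⟩ := pressure_const_outside hP hE hc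
  have hR : 0 < R := one_pos.trans_le hR1
  -- `‖DP‖ ≤ M_P`
  have hgradc : HasCompactSupport (fderiv ℝ P) := by
    have : fderiv ℝ P = fderiv ℝ (fun y => P y - p₀) := by
      funext y; simp [fderiv_sub_const]
    rw [this]
    exact (hasCompactSupport_sub_const hp).fderiv (𝕜 := ℝ)
  obtain ⟨MP, hMP⟩ := (hP.continuous_fderiv one_ne_zero).bounded_above_of_compact_support hgradc
  have hMP0 : 0 ≤ MP := (norm_nonneg _).trans (hMP 0)
  -- the players
  set hs : EuclideanSpace ℝ (Fin 3) → ℝ := fun x => U x 0 * U x 0 + U x 1 * U x 1 with hhs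
  set A : ℝ → ℝ := fun ε => ∫ x, hs x * ((cylSq x - ε ^ 2) / (cylSq x + ε ^ 2) ^ 2) with hA
  set L : ℝ := ∫ x, hs x / cylSq x with hL
  set Cχ : ℝ := ∫ x, |cutoffCoeff R x| with hCχ
  set I : ℝ → ℝ := fun ε => ∫ x, cutoff R x * (cylSq x * (2 * ε ^ 2 / (cylSq x + ε ^ 2) ^ 2)) with hI
  -- (1) the regularised Jiu–Xin identity: `A ε = ∫ (P − p₀) k_ε`
  have hAB : ∀ ε : ℝ, ε ≠ 0 → A ε = ∫ x, (P x - p₀) * (2 * ε ^ 2 / (cylSq x + ε ^ 2) ^ 2) := by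
    intro ε hε
    have hv := virial_identity hU hP hdiv hE hc hp (contDiff_testField (n := 1) hε)
    have h1 : ∫ x, ⟪U x, fderiv ℝ (testField ε) x (U x)⟫ = -A ε := by
      rw [hA, ← integral_neg]
      refine integral_congr_ae (Eventually.of_forall fun x => ?_)
      simp only [hhs]
      rw [inner_fderiv_testField_of_swirl_eq_zero hε (hsw x)]
      ring
    have h2 : ∫ x, (P x - p₀) * VectorCalculus.divergence (testField ε) x =
        ∫ x, (P x - p₀) * (2 * ε ^ 2 / (cylSq x + ε ^ 2) ^ 2) :=
      integral_congr_ae (Eventually.of_forall fun x => by simp only [divergence_testField hε])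
    rw [h1, h2] at hv
    linarith
  -- (2) `A → L`, (3) `I → 0`
  have hAL : Tendsto A (𝓝[>] 0) (𝓝 L) := tendsto_integral_horSq hU hc hax
  have hI0 : Tendsto I (𝓝[>] 0) (𝓝 0) := tendsto_integral_cutoff_cylSq_mul hR
  -- (4) `L ≤ M_P C_χ δ/2` for every `δ > 0`
  have hLle : ∀ δ : ℝ, 0 < δ → L ≤ MP * (δ / 2) * Cχ := by
    intro δ hδ
    have hup : Tendsto (fun ε => MP * (δ / 2) * Cχ + MP / (2 * δ) * I ε) (𝓝[>] 0)
        (𝓝 (MP * (δ / 2) * Cχ + MP / (2 * δ) * 0)) :=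
      tendsto_const_nhds.add (tendsto_const_nhds.mul hI0)
    rw [mul_zero, add_zero] at hup
    refine le_of_tendsto_of_tendsto hAL hup ?_
    filter_upwards [self_mem_nhdsWithin] with ε (hε : 0 < ε)
    rw [hAB ε hε.ne']
    exact pressure_integral_le hU hP hax hE hR hUR hp hMP hε.ne' hδ
  -- (5) hence `L ≤ 0`
  have hC0 : 0 ≤ Cχ := integral_nonneg fun x => abs_nonneg _
  have hL0 : L ≤ 0 := by
    refine le_of_forall_pos_le_add fun η hη => ?_
    have hK : 0 < MP * Cχ + 1 := by positivity
    have h := hLle (2 * η / (MP * Cχ + 1)) (by positivity)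
    calc L ≤ MP * (2 * η / (MP * Cχ + 1) / 2) * Cχ := h
      _ = η * (MP * Cχ / (MP * Cχ + 1)) := by field_simp
      _ ≤ η * 1 := by
          refine mul_le_mul_of_nonneg_left ?_ hη.le
          rw [div_le_one hK]; linarith
      _ = 0 + η := by ring
  -- (6) the continuous minorant `g = |U_h|²/(ρ²+1)` integrates to `0`, hence vanishes
  set g : EuclideanSpace ℝ (Fin 3) → ℝ := fun x => hs x / (cylSq x + 1) with hg
  have hs0 : ∀ x, 0 ≤ hs x := horSq_nonneg U
  have hq1 : ∀ x : EuclideanSpace ℝ (Fin 3), 0 < cylSq x + 1 := fun x => by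
    have := cylSq_nonneg x; positivity
  have hgc : Continuous g :=
    (continuous_horSq hU.continuous).div (continuous_cylSq.add continuous_const) fun x => (hq1 x).ne'
  have hg0 : ∀ x, 0 ≤ g x := fun x => div_nonneg (hs0 x) (hq1 x).le
  have hgle : ∀ x, g x ≤ hs x / cylSq x := by
    intro x
    by_cases hq : cylSq x = 0
    · have : hs x = 0 := horSq_eq_zero_of_cylSq_eq_zero hax hUd hq
      simp [hg, this]
    · exact div_le_div_of_nonneg_left (hs0 x) (lt_of_le_of_ne (cylSq_nonneg x) (Ne.symm hq)) (by linarith)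
  have hgs : HasCompactSupport g := hc.mono fun x hx => by
    rw [Function.mem_support] at hx ⊢
    contrapose! hx
    simp [hg, hhs, hx]
  have hgi : Integrable g := hgc.integrable_of_hasCompactSupport hgs
  have hfi : Integrable (fun x => hs x / cylSq x) := integrable_horSq_div hU hc hax
  have hgint : ∫ x, g x = 0 :=
    le_antisymm ((integral_mono hgi hfi hgle).trans hL0) (integral_nonneg hg0)
  have hg_zero : g = 0 := by
    have hae : g =ᵐ[volume] 0 := (integral_eq_zero_iff_of_nonneg hg0 hgi).mp hgint
    exact (Continuous.ae_eq_iff_eq volume hgc continuous_const).mp hae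
  -- (7) `U_h ≡ 0`
  have hU01 : ∀ x, U x 0 = 0 ∧ U x 1 = 0 := by
    intro x
    have h1 : g x = 0 := congrFun hg_zero x
    have h2 : hs x = 0 := by
      rw [hg, div_eq_zero_iff] at h1
      exact h1.resolve_right (hq1 x).ne'
    simp only [hhs] at h2
    constructor <;> nlinarith [mul_self_nonneg (U x 0), mul_self_nonneg (U x 1)]
  -- (8) `∂₂U₂ = div U = 0`
  set e : EuclideanSpace ℝ (Fin 3) := EuclideanSpace.single 2 (1 : ℝ) with he
  have hcoord0 : ∀ (i : Fin 3), (∀ x, U x i = 0) → ∀ y v, fderiv ℝ U y v i = 0 := by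
    intro i hi y v
    have hcomp : HasFDerivAt (fun z => U z i)
        ((EuclideanSpace.proj i : EuclideanSpace ℝ (Fin 3) →L[ℝ] ℝ).comp (fderiv ℝ U y)) y :=
      (EuclideanSpace.proj i : EuclideanSpace ℝ (Fin 3) →L[ℝ] ℝ).hasFDerivAt.comp y (hUd y).hasFDerivAt
    have hzero : HasFDerivAt (fun z => U z i) (0 : EuclideanSpace ℝ (Fin 3) →L[ℝ] ℝ) y := by
      have : (fun z => U z i) = fun _ => (0 : ℝ) := funext (hi ·)
      rw [this]; exact hasFDerivAt_const 0 y
    have := congrArg (fun L : EuclideanSpace ℝ (Fin 3) →L[ℝ] ℝ => L v) (hcomp.unique hzero)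
    simpa using this
  have hd2 : ∀ y, fderiv ℝ U y e 2 = 0 := by
    intro y
    have hdy := hdiv y
    rw [divergence_eq_sum_inner_fderiv (EuclideanSpace.basisFun (Fin 3) ℝ)] at hdy
    simp only [Fin.sum_univ_three, EuclideanSpace.basisFun_apply, EuclideanSpace.inner_single_left] at hdy
    have h0 := hcoord0 0 (fun x => (hU01 x).1) y (EuclideanSpace.single 0 (1 : ℝ))
    have h1 := hcoord0 1 (fun x => (hU01 x).2) y (EuclideanSpace.single 1 (1 : ℝ))
    rw [h0, h1] at hdy
    simpa [he] using hdy
  -- (9) `U₂` is constant on vertical lines, hence `0`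
  have he1 : ‖e‖ = 1 := by simp [he]
  have hU2 : ∀ x, U x 2 = 0 := by
    intro x
    set h : ℝ → ℝ := fun t => U (x + t • e) 2 with hh
    have hd : ∀ t, HasDerivAt h 0 t := by
      intro t
      have hl : HasDerivAt (fun t : ℝ => x + t • e) e t := by
        simpa using ((hasDerivAt_id t).smul_const e).const_add x
      have h1 : HasDerivAt (fun t : ℝ => U (x + t • e)) (fderiv ℝ U (x + t • e) e) t :=
        (hUd _).hasFDerivAt.comp_hasDerivAt t hl
      have h2 : HasDerivAt (fun t : ℝ => U (x + t • e) 2) (fderiv ℝ U (x + t • e) e 2) t :=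
        (EuclideanSpace.proj (2 : Fin 3) : EuclideanSpace ℝ (Fin 3) →L[ℝ] ℝ).hasFDerivAt.comp_hasDerivAt t h1
      rw [hd2] at h2
      exact h2
    have hconst := is_const_of_deriv_eq_zero (fun t => (hd t).differentiableAt) fun t => (hd t).deriv
    have hfar : h (R + 1 + ‖x‖) = 0 := by
      have hnot : x + (R + 1 + ‖x‖) • e ∉ Metric.closedBall (0 : EuclideanSpace ℝ (Fin 3)) R := by
        rw [Metric.mem_closedBall, dist_zero_right, not_le]
        have hn : ‖(R + 1 + ‖x‖) • e‖ = R + 1 + ‖x‖ := by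
          rw [norm_smul, he1, mul_one, Real.norm_of_nonneg (by positivity)]
        have htri : ‖(R + 1 + ‖x‖) • e‖ ≤ ‖x + (R + 1 + ‖x‖) • e‖ + ‖x‖ := by
          have := norm_sub_le (x + (R + 1 + ‖x‖) • e) x
          rwa [add_sub_cancel_left] at this
        linarith
      have hU0 : U (x + (R + 1 + ‖x‖) • e) = 0 :=
        image_eq_zero_of_notMem_tsupport fun h' => hnot (hUR h')
      simp [hh, hU0]
    have := hconst 0 (R + 1 + ‖x‖)
    rw [hfar] at this
    simpa [hh] using this
  -- (10) done
  funext x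
  ext i
  fin_cases i
  · simpa using (hU01 x).1
  · simpa using (hU01 x).2
  · simpa using hU2 x

/-- **(O1) No silent no-swirl block** — silent-shells sketch v1.4 l.257 `SilentNoSwirlBlock` NEGATED, by name (body
verbatim, `IsSteadyEulerC1` δ-unfolded): there is no non-zero compactly supported `C¹` steady Euler flow on `ℝ³` that is
axisymmetric without swirl.  So the multi-axis silent-shell compacton of the card has no building blocks; the obstruction
(O1) holds UNCONDITIONALLY (no printed fact assumed). [cite: JiuXin2008, Thm 5.3] -/
theorem not_silentNoSwirlBlock :
    ¬ ∃ (U : EuclideanSpace ℝ (Fin 3) → EuclideanSpace ℝ (Fin 3)) (P : EuclideanSpace ℝ (Fin 3) → ℝ),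
      (ContDiff ℝ 1 U ∧ ContDiff ℝ 1 P ∧ VectorCalculus.IsDivFree U ∧
          ∀ x, convect U U x + gradient P x = 0) ∧
        HasCompactSupport U ∧ U ≠ 0 ∧ IsAxisymmetric U ∧ HasNoSwirl U := by
  rintro ⟨U, P, hE, hc, hne, hax, hsw⟩
  exact hne (jiuXin_noSwirl_liouville U P hE hc hax hsw)

end Summit.NavierStokesRegularity.NavierStokesRegularity.Theorems.PoloidalLiouville.SilentShells

end
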